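import Literature.Geometry.Manifold.FreeCircleQuotient
import HarnessLib

/-!
# The orbit map `π : N → N/S¹` of a free smooth circle action is a `C^∞` submersion

Fourth file of the package on free smooth circle actions (`FreeCircleAction.lean`,
`FreeCircleFlowBox.lean`, `FreeCircleQuotient.lean`): the second half of Lee, *Introduction to
Smooth Manifolds*, 2nd ed., Thm. 21.10 for `G = S¹` — with the slice-chart smooth structure
`circleQuotientChartedSpace` / `isManifold_circleQuotient` on `N/S¹ = CircleQuotient N`, "the
quotient map `π : M → M/G` is a smooth submersion" — and the identification of `ker dπ` with the
orbit direction (the vertical bundle; for the null fibration of an origami form this is the null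
foliation, Cannas da Silva–Guillemin–Pires, *Symplectic Origami*, after Def. 2.5). Port to circle
actions of `Literature/Geometry/Lorentzian/StationaryOrbitProjection.lean`.

* `CircleSliceData.chart_circleQuotientMk_eventuallyEq` — local form: near `y₀`, in the slice
  chart at `p`, `π` reads `y ↦ coord (a₁ • y)` (`a₁ • y₀` in the tube);
  `CircleSliceData.surjective_mfderiv_coord` (`coord ∘ param = id`);
* `surjective_mfderiv_circle_smul` (each `a • ·` is a diffeomorphism);
* **`contMDiff_circleQuotientMk`** (`π` is `C^∞`), **`surjective_mfderiv_circleQuotientMk`**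
  (`π` is a submersion), `mfderiv_circleQuotientMk_apply_orbit` (`dπ` kills the orbit velocity)
  and **`finrank_ker_mfderiv_circleQuotientMk`** (`dim ker dπ_y = 1`).

Everything here is proved; no definitions, no facts.

## References

* J. M. Lee, *Introduction to Smooth Manifolds*, 2nd ed., Springer GTM 218 (2012), Thm. 21.10.
  [LeeSmoothManifolds2013]
* A. Cannas da Silva, V. Guillemin, A. R. Pires, *Symplectic Origami*, IMRN 2011 =
  arXiv:0909.4065, Def. 2.2, discussion after Def. 2.5. [CannasdasilvaGuilleminPires2010]
-/

noncomputable section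

open Set Filter Function TopologicalSpace Topology
open scoped Manifold ContDiff Topology

namespace Literature.Geometry.Manifold

/-! ### Local form of `π` in a slice chart -/

namespace CircleSliceData

variable {E : Type*} [NormedAddCommGroup E] [NormedSpace ℝ E] {N : Type*} [TopologicalSpace N]
  [ChartedSpace E N] [MulAction Circle N]
  {F : Type*} [NormedAddCommGroup F] [NormedSpace ℝ F] {p : N} (d : CircleSliceData E F p)

/-- If `y₀` lies on the orbit of `p` (`π y₀ = π p`), some group element carries `y₀` to the base
point `p = param 0` of the slice at `p`. [folklore] -/
theorem exists_smul_eq_param_zero {y₀ : N}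
    (hy₀ : circleQuotientMk y₀ = circleQuotientMk p) : ∃ a : Circle, a • y₀ = d.param 0 := by
  obtain ⟨a, ha⟩ := circleQuotientMk_eq_iff.1 hy₀.symm
  exact ⟨a, by rw [ha, d.param_zero]⟩

variable [ContinuousSMul Circle N]

/-- **Local form of `π` in a slice chart**: if `a₁ • y₀` lies in the tube of the slice at `p`,
then near `y₀` the projection read in the slice chart at `p` is `y ↦ coord (a₁ • y)`.
[cite: LeeSmoothManifolds2013, Thm. 21.10] -/
theorem chart_circleQuotientMk_eventuallyEq {y₀ : N} {a₁ : Circle} (ha₁ : a₁ • y₀ ∈ d.T) :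
    (fun y => d.chart (circleQuotientMk y)) =ᶠ[𝓝 y₀] fun y => d.coord (a₁ • y) := by
  have hc : Continuous fun y : N => a₁ • y := continuous_const_smul a₁
  filter_upwards [(hc.isOpen_preimage _ d.hTo).mem_nhds ha₁] with y hy
  rw [← circleQuotientMk_smul a₁ y]
  exact d.chart_apply_circleQuotientMk hy

omit [ContinuousSMul Circle N] in
/-- **The transversal coordinate has surjective differential at the base point**: `coord ∘ param`
is the identity on the open chart domain `dom ∋ 0`. [folklore] -/
theorem surjective_mfderiv_coord :
    Surjective (mfderiv 𝓘(ℝ, E) 𝓘(ℝ, F) d.coord (d.param 0)) := by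
  have hparam : MDifferentiableAt 𝓘(ℝ, F) 𝓘(ℝ, E) d.param 0 :=
    (d.contMDiffOn_param.contMDiffAt (d.isOpen_dom.mem_nhds d.zero_mem_dom)).mdifferentiableAt
      (by simp)
  have hcoord : MDifferentiableAt 𝓘(ℝ, E) 𝓘(ℝ, F) d.coord (d.param 0) :=
    (d.contMDiffOn_coord.contMDiffAt (d.hTo.mem_nhds (d.param_mem d.zero_mem_dom).2))
      |>.mdifferentiableAt (by simp)
  have hcomp := mfderiv_comp (0 : F) hcoord hparam
  have hid : mfderiv 𝓘(ℝ, F) 𝓘(ℝ, F) (d.coord ∘ d.param) 0 = ContinuousLinearMap.id ℝ F := by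
    have h1 : (d.coord ∘ d.param) =ᶠ[𝓝 (0 : F)] _root_.id :=
      Filter.eventuallyEq_of_mem (d.isOpen_dom.mem_nhds d.zero_mem_dom)
        (fun u hu => d.coord_param hu)
    rw [h1.mfderiv_eq]
    exact mfderiv_id
  rw [hid] at hcomp
  intro w
  refine ⟨mfderiv 𝓘(ℝ, F) 𝓘(ℝ, E) d.param 0 w, ?_⟩
  have := congrArg (fun L : F →L[ℝ] F => L w) hcomp
  exact this.symm

end CircleSliceData

/-! ### `π` is a `C^∞` submersion; its kernel is the orbit direction -/

section Projection

variable {k : ℕ} {N : Type*} [TopologicalSpace N] [ChartedSpace (EuclideanSpace ℝ (Fin k)) N]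
  [IsManifold (𝓡 k) ∞ N] [T2Space N] [MulAction Circle N]
  {F : Type*} [NormedAddCommGroup F] [NormedSpace ℝ F] [FiniteDimensional ℝ F]

omit [IsManifold (𝓡 k) ∞ N] [T2Space N] in
/-- The differential of the action of a group element is surjective (its right inverse is the
differential of the action of the inverse element). [folklore] -/
theorem surjective_mfderiv_circle_smul
    (hθ : ContMDiff ((𝓡 1).prod (𝓡 k)) (𝓡 k) ∞ (fun x : Circle × N => x.1 • x.2))
    (a : Circle) (y : N) : Surjective (mfderiv (𝓡 k) (𝓡 k) (fun q : N => a • q) y) := by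
  have hsm : ∀ b : Circle, ContMDiff (𝓡 k) (𝓡 k) ∞ (fun q : N => b • q) := fun b =>
    hθ.comp (contMDiff_const.prodMk contMDiff_id)
  -- surjectivity at every point of the form `a⁻¹ • z`, then `y = a⁻¹ • (a • y)`
  have key : ∀ z : N, Surjective (mfderiv (𝓡 k) (𝓡 k) (fun q : N => a • q) (a⁻¹ • z)) := by
    intro z
    have hA' : HasMFDerivAt (𝓡 k) (𝓡 k) (fun q : N => a⁻¹ • q) z
        (mfderiv (𝓡 k) (𝓡 k) (fun q : N => a⁻¹ • q) z) :=
      ((hsm a⁻¹).mdifferentiableAt (by simp)).hasMFDerivAt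
    have hB' : HasMFDerivAt (𝓡 k) (𝓡 k) (fun q : N => a • q) (a⁻¹ • z)
        (mfderiv (𝓡 k) (𝓡 k) (fun q : N => a • q) (a⁻¹ • z)) :=
      ((hsm a).mdifferentiableAt (by simp)).hasMFDerivAt
    have hcomp := hB'.comp z hA'
    have hid : HasMFDerivAt (𝓡 k) (𝓡 k) ((fun q : N => a • q) ∘ fun q : N => a⁻¹ • q) z
        (ContinuousLinearMap.id ℝ (TangentSpace (𝓡 k) z)) := by
      have heq : ((fun q : N => a • q) ∘ fun q : N => a⁻¹ • q) = id := by
        funext q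
        simp [smul_smul]
      rw [heq]
      exact hasMFDerivAt_id z
    have huniq := hcomp.mfderiv.symm.trans hid.mfderiv
    intro w
    refine ⟨mfderiv (𝓡 k) (𝓡 k) (fun q : N => a⁻¹ • q) z w, ?_⟩
    exact congrArg (fun L => L w) huniq
  have h := key (a • y)
  rwa [inv_smul_smul] at h

/-- **`π : N → N/S¹` is `C^∞`** for the slice-chart smooth structure of the orbit space
(`circleQuotientChartedSpace`, `isManifold_circleQuotient`): about every `y₀`, in the slice chart
at the chosen representative `p` of `π y₀`, `π` reads `y ↦ coord (a₁ • y)` for a group element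
`a₁` with `a₁ • y₀ = p` (`CircleSliceData.chart_circleQuotientMk_eventuallyEq`). Lee 2012,
Thm. 21.10 ("the quotient map `π : M → M/G` is a smooth submersion"). [cite: LeeSmoothManifolds2013, Thm. 21.10] -/
theorem contMDiff_circleQuotientMk
    (hθ : ContMDiff ((𝓡 1).prod (𝓡 k)) (𝓡 k) ∞ (fun x : Circle × N => x.1 • x.2))
    (hfree : ∀ (a : Circle) (x : N), a • x = x → a = 1)
    (hF : Module.finrank ℝ F + 1 = k) :
    letI := circleQuotientChartedSpace F hθ hfree hF
    ContMDiff (𝓡 k) 𝓘(ℝ, F) ∞ (circleQuotientMk : N → CircleQuotient N) := by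
  letI := circleQuotientChartedSpace F hθ hfree hF
  haveI : ContinuousSMul Circle N := ⟨hθ.continuous⟩
  intro y₀
  rw [contMDiffAt_iff_target]
  refine ⟨continuous_circleQuotientMk.continuousAt, ?_⟩
  -- the slice chart at the chosen representative `p` of `π y₀`
  set p : N := (circleQuotientMk y₀ : CircleQuotient N).out with hp
  set d : CircleSliceData (EuclideanSpace ℝ (Fin k)) F p := circleSliceDataAt hθ hfree hF p
    with hd
  have hpy : circleQuotientMk y₀ = circleQuotientMk p :=
    (Quotient.out_eq (circleQuotientMk y₀ : CircleQuotient N)).symm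
  obtain ⟨a₁, ha₁⟩ := d.exists_smul_eq_param_zero hpy
  have ha₁T : a₁ • y₀ ∈ d.T := by rw [ha₁]; exact (d.param_mem d.zero_mem_dom).2
  have hloc := d.chart_circleQuotientMk_eventuallyEq ha₁T
  have hθa : ContMDiff (𝓡 k) (𝓡 k) ∞ (fun y : N => a₁ • y) :=
    hθ.comp (contMDiff_const.prodMk contMDiff_id)
  have hG : ContMDiffAt (𝓡 k) 𝓘(ℝ, F) ∞ (d.coord ∘ fun y : N => a₁ • y) y₀ :=
    ContMDiffAt.comp (g := d.coord) (f := fun y : N => a₁ • y) y₀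
      (d.contMDiffOn_coord.contMDiffAt (d.hTo.mem_nhds ha₁T)) hθa.contMDiffAt
  have heq : (extChartAt 𝓘(ℝ, F) (circleQuotientMk y₀ : CircleQuotient N) ∘ circleQuotientMk)
      =ᶠ[𝓝 y₀] fun y => d.coord (a₁ • y) := by
    refine Filter.EventuallyEq.trans (Filter.Eventually.of_forall fun y => ?_) hloc
    simp only [comp_apply, extChartAt, OpenPartialHomeomorph.extend_coe, modelWithCornersSelf_coe,
      CompTriple.comp_eq]
    rfl
  exact hG.congr_of_eventuallyEq heq

/-- **`π : N → N/S¹` is a submersion**: its differential is surjective at every point (in the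
slice chart, `d(chart ∘ π)_{y₀} = d(coord)_p ∘ d(a₁ • ·)_{y₀}` is surjective and `d(chart)` is
injective). [cite: LeeSmoothManifolds2013, Thm. 21.10] -/
theorem surjective_mfderiv_circleQuotientMk
    (hθ : ContMDiff ((𝓡 1).prod (𝓡 k)) (𝓡 k) ∞ (fun x : Circle × N => x.1 • x.2))
    (hfree : ∀ (a : Circle) (x : N), a • x = x → a = 1)
    (hF : Module.finrank ℝ F + 1 = k) (y₀ : N) :
    letI := circleQuotientChartedSpace F hθ hfree hF
    Surjective (mfderiv (𝓡 k) 𝓘(ℝ, F) (circleQuotientMk : N → CircleQuotient N) y₀) := by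
  letI := circleQuotientChartedSpace F hθ hfree hF
  haveI : ContinuousSMul Circle N := ⟨hθ.continuous⟩
  haveI := isManifold_circleQuotient (F := F) hθ hfree hF
  set p : N := (circleQuotientMk y₀ : CircleQuotient N).out with hp
  set d : CircleSliceData (EuclideanSpace ℝ (Fin k)) F p := circleSliceDataAt hθ hfree hF p
    with hd
  have hpy : circleQuotientMk y₀ = circleQuotientMk p :=
    (Quotient.out_eq (circleQuotientMk y₀ : CircleQuotient N)).symm
  obtain ⟨a₁, ha₁⟩ := d.exists_smul_eq_param_zero hpy
  have ha₁T : a₁ • y₀ ∈ d.T := by rw [ha₁]; exact (d.param_mem d.zero_mem_dom).2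
  have hloc := d.chart_circleQuotientMk_eventuallyEq ha₁T
  -- differentiability of the pieces
  have hπ : MDifferentiableAt (𝓡 k) 𝓘(ℝ, F) (circleQuotientMk : N → CircleQuotient N) y₀ :=
    ((contMDiff_circleQuotientMk hθ hfree hF) y₀).mdifferentiableAt (by simp)
  have hchart_eq : chartAt F (circleQuotientMk y₀ : CircleQuotient N) = d.chart := rfl
  have hmem : (circleQuotientMk y₀ : CircleQuotient N) ∈ d.chart.source := by
    rw [hpy]; exact d.mem_chart_source
  have hch : d.chart.MDifferentiable 𝓘(ℝ, F) 𝓘(ℝ, F) :=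
    hchart_eq ▸ mdifferentiable_chart (circleQuotientMk y₀ : CircleQuotient N)
  have hθa : ContMDiff (𝓡 k) (𝓡 k) ∞ (fun y : N => a₁ • y) :=
    hθ.comp (contMDiff_const.prodMk contMDiff_id)
  have hθd : MDifferentiableAt (𝓡 k) (𝓡 k) (fun y : N => a₁ • y) y₀ :=
    hθa.contMDiffAt.mdifferentiableAt (by simp)
  have hcd : MDifferentiableAt (𝓡 k) 𝓘(ℝ, F) d.coord (a₁ • y₀) :=
    (d.contMDiffOn_coord.contMDiffAt (d.hTo.mem_nhds ha₁T)).mdifferentiableAt (by simp)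
  -- the two expressions of `d(chart ∘ π)_{y₀}`
  have h1 : mfderiv (𝓡 k) 𝓘(ℝ, F) (fun y => d.chart (circleQuotientMk y)) y₀ =
      (mfderiv 𝓘(ℝ, F) 𝓘(ℝ, F) d.chart (circleQuotientMk y₀)).comp
        (mfderiv (𝓡 k) 𝓘(ℝ, F) (circleQuotientMk : N → CircleQuotient N) y₀) :=
    mfderiv_comp y₀ (hch.mdifferentiableAt hmem) hπ
  have h2 : mfderiv (𝓡 k) 𝓘(ℝ, F) (fun y => d.chart (circleQuotientMk y)) y₀ =
      (mfderiv (𝓡 k) 𝓘(ℝ, F) d.coord (a₁ • y₀)).comp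
        (mfderiv (𝓡 k) (𝓡 k) (fun y : N => a₁ • y) y₀) := by
    rw [hloc.mfderiv_eq]
    exact mfderiv_comp y₀ hcd hθd
  -- surjectivity of `d(coord) ∘ d(a₁ • ·)`
  have hsurj : Surjective ((mfderiv (𝓡 k) 𝓘(ℝ, F) d.coord (a₁ • y₀)).comp
      (mfderiv (𝓡 k) (𝓡 k) (fun y : N => a₁ • y) y₀)) := by
    rw [ContinuousLinearMap.coe_comp]
    refine Surjective.comp ?_ (surjective_mfderiv_circle_smul hθ a₁ y₀)
    rw [ha₁]
    exact d.surjective_mfderiv_coord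
  -- conclude by injectivity of `d(chart)`
  intro ζ
  obtain ⟨v, hv⟩ := hsurj (mfderiv 𝓘(ℝ, F) 𝓘(ℝ, F) d.chart (circleQuotientMk y₀) ζ)
  refine ⟨v, hch.mfderiv_injective hmem ?_⟩
  have := congrArg (fun L => L v) (h2.symm.trans h1)
  simp only [ContinuousLinearMap.coe_comp, comp_apply] at this hv
  rw [← this]
  exact hv

/-- **`dπ` kills the orbit direction**: `dπ_y (d/dt|₀ exp t • y) = 0`, since `π` is constant along
the orbit. [cite: LeeSmoothManifolds2013, Thm. 21.10] -/
theorem mfderiv_circleQuotientMk_apply_orbit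
    (hθ : ContMDiff ((𝓡 1).prod (𝓡 k)) (𝓡 k) ∞ (fun x : Circle × N => x.1 • x.2))
    (hfree : ∀ (a : Circle) (x : N), a • x = x → a = 1)
    (hF : Module.finrank ℝ F + 1 = k) (y : N) :
    letI := circleQuotientChartedSpace F hθ hfree hF
    mfderiv (𝓡 k) 𝓘(ℝ, F) (circleQuotientMk : N → CircleQuotient N) y
      (mfderiv 𝓘(ℝ, ℝ) (𝓡 k) (fun t : ℝ => Circle.exp t • y) 0 (1 : ℝ)) = 0 := by
  letI := circleQuotientChartedSpace F hθ hfree hF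
  have hγ : HasMFDerivAt 𝓘(ℝ, ℝ) (𝓡 k) (fun t : ℝ => Circle.exp t • y) 0
      (mfderiv 𝓘(ℝ, ℝ) (𝓡 k) (fun t : ℝ => Circle.exp t • y) 0) :=
    ((contMDiff_circleOrbit (θ := fun (a : Circle) (x : N) => a • x) hθ y).mdifferentiableAt
      (by decide)).hasMFDerivAt
  have h0y : Circle.exp 0 • y = y := by rw [Circle.exp_zero, one_smul]
  have hπd : MDifferentiableAt (𝓡 k) 𝓘(ℝ, F) (circleQuotientMk : N → CircleQuotient N)
      (Circle.exp 0 • y) :=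
    ((contMDiff_circleQuotientMk hθ hfree hF) _).mdifferentiableAt (by simp)
  have hcomp := hπd.hasMFDerivAt.comp 0 hγ
  have hconst : ((circleQuotientMk : N → CircleQuotient N) ∘ fun t : ℝ => Circle.exp t • y) =
      fun _ => circleQuotientMk y := by
    funext t
    exact circleQuotientMk_smul _ _
  rw [hconst] at hcomp
  have h0 : HasMFDerivAt 𝓘(ℝ, ℝ) 𝓘(ℝ, F) (fun _ : ℝ => (circleQuotientMk y : CircleQuotient N)) 0
      (0 : TangentSpace 𝓘(ℝ, ℝ) (0 : ℝ) →L[ℝ]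
        TangentSpace 𝓘(ℝ, F) (circleQuotientMk y : CircleQuotient N)) :=
    hasMFDerivAt_const _ _
  have heq := hcomp.mfderiv.symm.trans h0.mfderiv
  rw [h0y] at heq
  exact congrArg (fun L => L (1 : ℝ)) heq

/-- **The kernel of `dπ_y` is the orbit direction** (a line): `dπ_y` is surjective onto the
`(k-1)`-dimensional model, so its kernel is one-dimensional, and it contains the non-zero
velocity of the orbit (`mfderiv_circleOrbit_apply_one_ne_zero`). [cite: LeeSmoothManifolds2013, Thm. 21.10] -/
theorem finrank_ker_mfderiv_circleQuotientMk
    (hθ : ContMDiff ((𝓡 1).prod (𝓡 k)) (𝓡 k) ∞ (fun x : Circle × N => x.1 • x.2))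
    (hfree : ∀ (a : Circle) (x : N), a • x = x → a = 1)
    (hF : Module.finrank ℝ F + 1 = k) (y : N) :
    letI := circleQuotientChartedSpace F hθ hfree hF
    Module.finrank ℝ (LinearMap.ker (mfderiv (𝓡 k) 𝓘(ℝ, F)
      (circleQuotientMk : N → CircleQuotient N) y).toLinearMap) = 1 := by
  letI := circleQuotientChartedSpace F hθ hfree hF
  haveI : FiniteDimensional ℝ (TangentSpace (𝓡 k) y) :=
    inferInstanceAs (FiniteDimensional ℝ (EuclideanSpace ℝ (Fin k)))
  set L := (mfderiv (𝓡 k) 𝓘(ℝ, F) (circleQuotientMk : N → CircleQuotient N) y).toLinearMap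
    with hL
  have hsurj : LinearMap.range L = ⊤ :=
    LinearMap.range_eq_top.2 (surjective_mfderiv_circleQuotientMk hθ hfree hF y)
  have h := LinearMap.finrank_range_add_finrank_ker L
  rw [hsurj, finrank_top] at h
  have hE : Module.finrank ℝ (TangentSpace (𝓡 k) y) = k := finrank_euclideanSpace_fin
  have hF' : Module.finrank ℝ (TangentSpace 𝓘(ℝ, F) (circleQuotientMk y : CircleQuotient N)) =
      Module.finrank ℝ F := rfl
  rw [hE, hF'] at h
  omega

end Projection

end Literature.Geometry.Manifold

end
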